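import Summits.QuantumFields.YangMills.Theorems.EquipartitionCriticalityCriticalContinuumLimitStubAdmissibleGivesGapTorusRP
import Summits.QuantumFields.YangMills.Theorems.ConvexGribovBodyContinuumLegGivenGapStubRpShift
import Literature.MathematicalPhysics.QuantumFieldTheory.SpeciesTimeReflection
import HarnessLib

/-!
# `ContinuumLegGivenGap` (stmt-QuantumFields-15828), line `Sketch`, reshape 17-CS, helper 1 of `stub_csclOfLock`:
# the two complex OS forms of the odd torus — Hermitian symmetry, positivity, Cauchy–Schwarz, shift identities

On the torus of side `2S+1` at `β ≥ 0`, for bounded measurable COMPLEX observables `X, Y` of the `ℤ⁴` gauge field read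
on the periodic lift `Ũ = torusLift _ U`, with `Θ = gaugeTimeReflect` (bond reflection `t ↦ −1 − t`) and
`τᶜ = configShift (−c e₀)`: `cscl_cs_of_psd` (abstract Cauchy–Schwarz from positivity of a Hermitian datum);
`cscl_integral_shift`, `cscl_integral_reflect_swap`, `cscl_shift_pair` (translation / reflection invariance of
Wilson's torus measure for complex integrands; `∫ conj X(τᵃΘŨ) Y(τᶜŨ) = ∫ conj X(ΘŨ) Y(τ^{a+c}Ũ)`);
`cscl_cfgReflect_eq` (the SITE reflection of `SpeciesTimeReflection` is `cfgReflect = τ⁻¹ ∘ Θ`, so the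
`cfgReflect`-pairing of route ParabolicTrajectory's matching is a bond-form value one shift down,
`cscl_site_pairing_eq`); `cscl_bond_herm` / `cscl_site_herm` (the bond form `∫ conj X(ΘŨ) Y(Ũ)` and the site form
`∫ conj X(ΘŨ) Y(τŨ)` are Hermitian); `cscl_form_expand` (sesquilinear expansion on `X + cY`). The Cauchy–Schwarz
inequalities themselves are in helper 2 (`…CsclTorusChord`).
Registered anchor: `cscl_anchor_forms`. Refs: Osterwalder–Seiler 1978 §2; Glimm–Jaffe 1987 §6.1. No definitions.
-/

noncomputable section

open scoped ComplexConjugate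
open MeasureTheory Filter
open Literature.MathematicalPhysics.QuantumFieldTheory Literature.MathematicalPhysics.QuantumLattice
open Summit.QuantumFields.YangMills.Theorems.ClusteringToYangMills.Reconstructible
open Summit.QuantumFields.YangMills.Theorems.CriticalContinuumLimit.AdmissibleGap (maxTime torus_rp_bond torus_rp_site)

namespace Summit.QuantumFields.YangMills.Theorems.ContinuumLegGivenGap

/-! ### Abstract Cauchy–Schwarz for a positive Hermitian datum -/

/-- **Cauchy–Schwarz from positivity.** If `bXX + 2 Re(c·bXY) + |c|² bYY ≥ 0` for every complex `c` (the
expansion of `Q(X + cY, X + cY) ≥ 0` for a Hermitian form), then `‖bXY‖² ≤ bXX · bYY`. [folklore] -/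
theorem cscl_cs_of_psd (bXX bYY : ℝ) (bXY : ℂ)
    (h : ∀ c : ℂ, 0 ≤ bXX + 2 * (c * bXY).re + ‖c‖ ^ 2 * bYY) : ‖bXY‖ ^ 2 ≤ bXX * bYY := by
  have hXX : 0 ≤ bXX := by simpa using h 0
  -- `bYY ≥ 0`: take `c = t` real large along the direction killing the middle term? simpler: `c = -t conj bXY`
  have key : ∀ t : ℝ, 0 ≤ t → 0 ≤ bXX - 2 * t * ‖bXY‖ ^ 2 + t ^ 2 * ‖bXY‖ ^ 2 * bYY := by
    intro t ht
    have h1 := h (-(t : ℂ) * conj bXY)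
    have hre : ((-(t : ℂ) * conj bXY) * bXY).re = -t * ‖bXY‖ ^ 2 := by
      rw [mul_assoc, Complex.conj_mul' bXY, ← Complex.ofReal_pow, ← Complex.ofReal_neg, ← Complex.ofReal_mul,
        Complex.ofReal_re]
    have hnorm : ‖-(t : ℂ) * conj bXY‖ ^ 2 = t ^ 2 * ‖bXY‖ ^ 2 := by
      rw [norm_mul, norm_neg, Complex.norm_real, Complex.norm_conj, Real.norm_eq_abs, mul_pow, sq_abs]
    rw [hre, hnorm] at h1
    nlinarith [h1]
  by_cases hb : bXY = 0
  · rw [hb, norm_zero]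
    have hYY0 : 0 ≤ bYY := by
      have h1 := h 1
      simp only [one_mul, hb, Complex.zero_re, mul_zero, add_zero, norm_one, one_pow] at h1
      -- `0 ≤ bXX + bYY` is not enough in general; use `c = t` large: `0 ≤ bXX + t² bYY`
      by_contra hneg
      push Not at hneg
      have h2 := h ((Real.sqrt ((bXX + 1) / -bYY) : ℝ) : ℂ)
      simp only [hb, mul_zero, Complex.zero_re, add_zero, Complex.norm_real, Real.norm_eq_abs,
        sq_abs] at h2
      rw [Real.sq_sqrt (by have : 0 < -bYY := by linarith
                           positivity)] at h2
      have hne : bYY ≠ 0 := hneg.ne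
      have : (bXX + 1) / -bYY * bYY = -(bXX + 1) := by field_simp
      linarith
    simpa using mul_nonneg hXX hYY0
  have hn : 0 < ‖bXY‖ ^ 2 := pow_pos (norm_pos_iff.2 hb) 2
  -- `bYY ≥ 0`
  have hYY : 0 ≤ bYY := by
    by_contra hneg
    push Not at hneg
    -- large `t` makes the quadratic negative
    obtain ⟨t, ht1, ht2⟩ : ∃ t : ℝ, 1 ≤ t ∧ bXX < t * ‖bXY‖ ^ 2 := by
      refine ⟨max 1 (bXX / ‖bXY‖ ^ 2 + 1), le_max_left _ _, ?_⟩
      have : bXX / ‖bXY‖ ^ 2 + 1 ≤ max 1 (bXX / ‖bXY‖ ^ 2 + 1) := le_max_right _ _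
      have h2 : bXX < (bXX / ‖bXY‖ ^ 2 + 1) * ‖bXY‖ ^ 2 := by
        rw [add_mul, div_mul_cancel₀ _ hn.ne']; linarith
      exact h2.trans_le (mul_le_mul_of_nonneg_right this hn.le)
    have h3 := key t (by linarith)
    have h4 : t ^ 2 * ‖bXY‖ ^ 2 * bYY ≤ 0 :=
      mul_nonpos_of_nonneg_of_nonpos (by positivity) hneg.le
    nlinarith
  rcases eq_or_lt_of_le hYY with hY0 | hYpos
  · -- `bYY = 0`: the linear term must vanish, contradiction with `bXY ≠ 0` unless … : take `t` large
    exfalso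
    have h3 := key (bXX / ‖bXY‖ ^ 2 + 1) (by positivity)
    rw [← hY0] at h3
    have : bXX - 2 * (bXX / ‖bXY‖ ^ 2 + 1) * ‖bXY‖ ^ 2 + (bXX / ‖bXY‖ ^ 2 + 1) ^ 2 * ‖bXY‖ ^ 2 * 0 =
        -bXX - 2 * ‖bXY‖ ^ 2 := by field_simp; ring
    rw [this] at h3
    nlinarith
  · -- optimise: `t = 1 / bYY`
    have h3 := key (1 / bYY) (by positivity)
    have : bXX - 2 * (1 / bYY) * ‖bXY‖ ^ 2 + (1 / bYY) ^ 2 * ‖bXY‖ ^ 2 * bYY =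
        bXX - ‖bXY‖ ^ 2 / bYY := by field_simp; ring
    rw [this] at h3
    have h4 : ‖bXY‖ ^ 2 / bYY ≤ bXX := by linarith
    rwa [div_le_iff₀ hYpos] at h4

/-! ### Reflection and translation invariance for complex observables of the lift -/

section Torus

variable {G : Type} [Group G] [TopologicalSpace G] [IsTopologicalGroup G] [CompactSpace G]
  [MeasurableSpace G] [BorelSpace G] {N : ℕ} (ρ : G →* Matrix (Fin N) (Fin N) ℂ)

/-- **Translation invariance along the lift** (complex integrands): `∫ g(θ_v Ũ) dμ = ∫ g(Ũ) dμ`.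
[folklore] -/
theorem cscl_integral_shift (β : ℝ) (L : ℕ) [NeZero L]
    (v : Literature.Probability.LatticeModels.Site 4) (g : LGConfig 4 G → ℂ) :
    ∫ U, g (configShift v (torusLift L U)) ∂(wilsonMeasure (d := 4) (L := L) ρ β) =
      ∫ U, g (torusLift L U) ∂(wilsonMeasure (d := 4) (L := L) ρ β) := by
  simp_rw [configShift_torusLift]
  have h := wilsonExpectation_comp_torusConfigShift (d := 4) (L := L) ρ β
    (Literature.Probability.LatticeModels.Torus.proj L v) (g ∘ torusLift L)
  simpa only [wilsonExpectation, Function.comp_apply] using h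

/-- **Reflection swap**: `∫ g(ΘŨ, Ũ) dμ = ∫ g(Ũ, ΘŨ) dμ` (`Θ = gaugeTimeReflect`; `Θ ∘ lift = lift ∘ T_{−2e₀} ∘ Θ_T`,
`Θ_T`- and translation invariance of Wilson's torus measure, `ΘΘ = 1`). [folklore] -/
theorem cscl_integral_reflect_swap (hρ : Continuous ρ) (β : ℝ) (L : ℕ) [NeZero L]
    (g : LGConfig 4 G → LGConfig 4 G → ℂ) :
    ∫ U, g (gaugeTimeReflect (torusLift L U)) (torusLift L U) ∂(wilsonMeasure (d := 4) (L := L) ρ β) =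
      ∫ U, g (torusLift L U) (gaugeTimeReflect (torusLift L U)) ∂(wilsonMeasure (d := 4) (L := L) ρ β) := by
  -- substitute `U ↦ T_{-2e₀} (Θ_T U)`, which is measure preserving and realises `Ũ ↦ ΘŨ`
  have h1 := wilsonExpectation_comp_timeReflect (L := L) ρ hρ β
    ((fun U => g (torusLift L U) (gaugeTimeReflect (torusLift L U))) ∘
      torusConfigShift (Pi.single 0 (-2)))
  have h2 := wilsonExpectation_comp_torusConfigShift (d := 4) (L := L) ρ β (Pi.single 0 (-2))
    (fun U => g (torusLift L U) (gaugeTimeReflect (torusLift L U)))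
  simp only [wilsonExpectation, Function.comp_apply] at h1 h2
  rw [h2] at h1
  rw [← h1]
  refine integral_congr_ae (Eventually.of_forall fun U => ?_)
  have hlift : torusLift L (torusConfigShift (Pi.single 0 (-2)) (GaugeConfig.timeReflect U)) =
      gaugeTimeReflect (torusLift L U) := (gaugeTimeReflect_torusLift U).symm
  simp only [hlift, gaugeTimeReflect_gaugeTimeReflect]

/-- **The shift identity** (complex): `∫ conj X(τᵃΘŨ) · Y(τᶜŨ) dμ = ∫ conj X(ΘŨ) · Y(τ^{a+c}Ũ) dμ`
(`τᵃΘ = Θτ^{−a}`, then translate by `a e₀`). [folklore] -/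
theorem cscl_shift_pair (β : ℝ) (L : ℕ) [NeZero L] (X Y : LGConfig 4 G → ℂ) (a c : ℤ) :
    ∫ U, conj (X (configShift (-(Pi.single 0 a)) (gaugeTimeReflect (torusLift L U)))) *
        Y (configShift (-(Pi.single 0 c)) (torusLift L U)) ∂(wilsonMeasure (d := 4) (L := L) ρ β) =
      ∫ U, conj (X (gaugeTimeReflect (torusLift L U))) *
        Y (configShift (-(Pi.single 0 (a + c))) (torusLift L U)) ∂(wilsonMeasure (d := 4) (L := L) ρ β) := by
  have h := cscl_integral_shift ρ β L (-(Pi.single 0 a))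
    (fun W => conj (X (gaugeTimeReflect (configShift (Pi.single 0 a) W))) *
      Y (configShift (-(Pi.single 0 c)) W))
  simp only [rpShift_configShift_neg_cancel, rpShift_configShift_configShift] at h
  simp_rw [rpShift_configShift_gaugeTimeReflect]
  exact h.symm

omit [TopologicalSpace G] [IsTopologicalGroup G] [CompactSpace G] [BorelSpace G] in
/-- **`cfgReflect = τ⁻¹ ∘ Θ`**: the site reflection `t ↦ −t` of `SpeciesTimeReflection` is the bond reflection
`gaugeTimeReflect` (`t ↦ −1 − t`) followed by the translation `configShift e₀`. [folklore] -/
theorem cscl_cfgReflect_eq (U : LGConfig 4 G) :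
    cfgReflect U = configShift (Pi.single 0 1) (gaugeTimeReflect U) := by
  funext e
  rcases e with ⟨x, i⟩
  have hsp : latticeTimeReflection 4 (x - Pi.single 0 1) = siteReflect x := by
    ext j
    by_cases hj : j = 0
    · subst hj; simp [siteReflect_apply_zero]; ring
    · simp [hj, siteReflect_apply_of_ne _ hj]
  have htm : latticeTimeReflection 4 (x - Pi.single 0 1 + Pi.single 0 1) = siteReflect x - Pi.single 0 1 := by
    ext j
    by_cases hj : j = 0
    · subst hj; simp [siteReflect_apply_zero]; ring
    · simp [hj, siteReflect_apply_of_ne _ hj]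
  by_cases hi : i = 0
  · subst hi
    simp only [cfgReflect, reflectEdge, ↓reduceIte, Literature.MathematicalPhysics.QuantumLattice.configShift_apply,
      gaugeTimeReflect_apply, htm]
  · simp only [cfgReflect, reflectEdge, if_neg hi, Literature.MathematicalPhysics.QuantumLattice.configShift_apply,
      gaugeTimeReflect_apply, hsp]

/-- **The `cfgReflect`-pairing is a bond-form value one shift down**:
`∫ conj X(cfgReflect Ũ) · Y(τˢŨ) dμ = ∫ conj X(ΘŨ) · Y(τ^{s−1}Ũ) dμ`. [folklore] -/
theorem cscl_site_pairing_eq (β : ℝ) (L : ℕ) [NeZero L] (X Y : LGConfig 4 G → ℂ) (s : ℤ) :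
    ∫ U, conj (X (cfgReflect (torusLift L U))) * Y (configShift (-(Pi.single 0 s)) (torusLift L U))
        ∂(wilsonMeasure (d := 4) (L := L) ρ β) =
      ∫ U, conj (X (gaugeTimeReflect (torusLift L U))) *
        Y (configShift (-(Pi.single 0 (-1 + s))) (torusLift L U)) ∂(wilsonMeasure (d := 4) (L := L) ρ β) := by
  have h := cscl_shift_pair ρ β L X Y (-1) s
  simp only [Pi.single_neg, neg_neg] at h
  simp_rw [cscl_cfgReflect_eq]
  exact h

/-! ### Hermitian symmetry of the two forms -/

/-- **The bond form is Hermitian**: `∫ conj Y(ΘŨ) X(Ũ) = conj ∫ conj X(ΘŨ) Y(Ũ)`. [folklore] -/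
theorem cscl_bond_herm (hρ : Continuous ρ) (β : ℝ) (L : ℕ) [NeZero L] (X Y : LGConfig 4 G → ℂ) :
    ∫ U, conj (Y (gaugeTimeReflect (torusLift L U))) * X (torusLift L U) ∂(wilsonMeasure (d := 4) (L := L) ρ β) =
      conj (∫ U, conj (X (gaugeTimeReflect (torusLift L U))) * Y (torusLift L U)
        ∂(wilsonMeasure (d := 4) (L := L) ρ β)) := by
  rw [← integral_conj]
  simp only [map_mul, Complex.conj_conj]
  have h := cscl_integral_reflect_swap ρ hρ β L fun A B => conj (Y A) * X B
  -- `h : ∫ conj Y(ΘŨ) X(Ũ) = ∫ conj Y(Ũ) X(ΘŨ)`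
  rw [h]
  exact integral_congr_ae (Eventually.of_forall fun U => by simp only; ring)

/-- **The site form is Hermitian**: `∫ conj Y(ΘŨ) X(τŨ) = conj ∫ conj X(ΘŨ) Y(τŨ)` (reflection swap,
`τΘ = Θτ⁻¹`, translation by `e₀`). [folklore] -/
theorem cscl_site_herm (hρ : Continuous ρ) (β : ℝ) (L : ℕ) [NeZero L] (X Y : LGConfig 4 G → ℂ) :
    ∫ U, conj (Y (gaugeTimeReflect (torusLift L U))) * X (gaugeTimeShift (torusLift L U))
        ∂(wilsonMeasure (d := 4) (L := L) ρ β) =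
      conj (∫ U, conj (X (gaugeTimeReflect (torusLift L U))) * Y (gaugeTimeShift (torusLift L U))
        ∂(wilsonMeasure (d := 4) (L := L) ρ β)) := by
  rw [← integral_conj]
  simp only [map_mul, Complex.conj_conj]
  -- RHS: swap the reflection, `∫ X(ΘŨ) conj Y(τŨ) = ∫ X(Ũ) conj Y(τΘŨ)`
  have hR := cscl_integral_reflect_swap ρ hρ β L fun A B => X A * conj (Y (gaugeTimeShift B))
  rw [hR]
  -- LHS: translate by `e₀`, `∫ conj Y(ΘŨ) X(τŨ) = ∫ conj Y(τΘŨ) X(Ũ)` (`τΘτ = Θ`)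
  have hL := cscl_integral_shift ρ β L (-(Pi.single 0 1))
    (fun W => conj (Y (gaugeTimeShift (gaugeTimeReflect W))) * X W)
  have hL' : ∫ U, conj (Y (gaugeTimeReflect (torusLift L U))) * X (gaugeTimeShift (torusLift L U))
      ∂(wilsonMeasure (d := 4) (L := L) ρ β) =
      ∫ U, conj (Y (gaugeTimeShift (gaugeTimeReflect (torusLift L U)))) * X (torusLift L U)
        ∂(wilsonMeasure (d := 4) (L := L) ρ β) := by
    rw [← hL]
    refine integral_congr_ae (Eventually.of_forall fun U => ?_)
    have h3 : gaugeTimeShift (gaugeTimeReflect (configShift (-(Pi.single 0 1)) (torusLift L U))) =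
        gaugeTimeReflect (torusLift L U) := by
      have := gaugeTimeShift_gaugeTimeReflect_gaugeTimeShift (G := G) (torusLift L U)
      simpa only [gaugeTimeShift] using this
    show conj (Y (gaugeTimeReflect (torusLift L U))) * X (gaugeTimeShift (torusLift L U)) =
      conj (Y (gaugeTimeShift (gaugeTimeReflect (configShift (-(Pi.single 0 1)) (torusLift L U))))) *
        X (configShift (-(Pi.single 0 1)) (torusLift L U))
    rw [h3]
    rfl
  rw [hL']
  exact integral_congr_ae (Eventually.of_forall fun U => by simp only; ring)

/-! ### Positivity and Cauchy–Schwarz of the two forms -/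

omit [Group G] [TopologicalSpace G] [IsTopologicalGroup G] [CompactSpace G] [MeasurableSpace G] [BorelSpace G] in
/-- A cylinder observable on a larger edge set. [folklore] -/
theorem cscl_isCylinder_mono {α : Type*} {F : LGConfig 4 G → α} {Λ Λ' : Finset (Literature.MathematicalPhysics.QuantumLattice.ZdEdge 4)}
    (hF : IsCylinder F Λ) (h : Λ ⊆ Λ') : IsCylinder F Λ' :=
  fun _ _ hUV => hF fun e he => hUV e (Finset.mem_coe.2 (h (Finset.mem_coe.1 he)))

omit [Group G] [TopologicalSpace G] [IsTopologicalGroup G] [CompactSpace G] [MeasurableSpace G] [BorelSpace G] in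
/-- Linear combinations of two cylinder observables are cylinder observables on the union. [folklore] -/
theorem cscl_isCylinder_add_smul {X Y : LGConfig 4 G → ℂ} {ΛX ΛY : Finset (Literature.MathematicalPhysics.QuantumLattice.ZdEdge 4)}
    (hX : IsCylinder X ΛX) (hY : IsCylinder Y ΛY) (c : ℂ) :
    IsCylinder (fun V => X V + c * Y V) (ΛX ∪ ΛY) := by
  intro U V hUV
  have h1 : X U = X V := cscl_isCylinder_mono hX Finset.subset_union_left hUV
  have h2 : Y U = Y V := cscl_isCylinder_mono hY Finset.subset_union_right hUV
  simp only [h1, h2]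

/-- `maxTime` of a union is the larger `maxTime`. [folklore] -/
theorem cscl_maxTime_union (Λ Λ' : Finset (Literature.MathematicalPhysics.QuantumLattice.ZdEdge 4)) :
    maxTime (Λ ∪ Λ') = max (maxTime Λ) (maxTime Λ') := by
  unfold maxTime
  rw [Finset.sup_union]

/-- Bounded measurable complex observables of the torus are integrable for Wilson's measure. [folklore] -/
theorem cscl_integrable (hρ : Continuous ρ) (β : ℝ) {L : ℕ} [NeZero L] {f : GaugeConfig 4 L G → ℂ}
    (hf : Measurable f) (hb : ∃ C : ℝ, ∀ U, ‖f U‖ ≤ C) :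
    Integrable f (wilsonMeasure (d := 4) (L := L) ρ β) := by
  haveI := isProbabilityMeasure_wilsonMeasure (d := 4) (L := L) ρ hρ β
  obtain ⟨C, hC⟩ := hb
  exact Integrable.of_bound hf.aestronglyMeasurable C (Eventually.of_forall hC)

omit [CompactSpace G] in
/-- Measurability of an observable of the lift read through `Θ`, `τᶜ`. [folklore] -/
theorem cscl_measurable_comp {X : LGConfig 4 G → ℂ} (hX : Measurable X) (L : ℕ) (c : ℤ) :
    Measurable (fun U : GaugeConfig 4 L G => X (gaugeTimeReflect (torusLift L U))) ∧
      Measurable (fun U : GaugeConfig 4 L G => X (configShift (-(Pi.single 0 c)) (torusLift L U))) :=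
  ⟨hX.comp (measurable_gaugeTimeReflect.comp (measurable_torusLift _)),
    hX.comp ((configShift _).measurable.comp (measurable_torusLift _))⟩

/-- **Expansion of the generalised form** `∫ conj F(ΘŨ) F(τᶜŨ)` on `F = X + cY`:
`= Q(X,X) + c Q(X,Y) + conj c · Q(Y,X) + |c|² Q(Y,Y)`. [folklore] -/
theorem cscl_form_expand (hρ : Continuous ρ) (β : ℝ) {L : ℕ} [NeZero L] {X Y : LGConfig 4 G → ℂ}
    (hXm : Measurable X) (hYm : Measurable Y) (hXb : ∃ C : ℝ, ∀ U, ‖X U‖ ≤ C) (hYb : ∃ C : ℝ, ∀ U, ‖Y U‖ ≤ C)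
    (c : ℂ) (s : ℤ) :
    ∫ U, conj (X (gaugeTimeReflect (torusLift L U)) + c * Y (gaugeTimeReflect (torusLift L U))) *
        (X (configShift (-(Pi.single 0 s)) (torusLift L U)) + c * Y (configShift (-(Pi.single 0 s)) (torusLift L U)))
        ∂(wilsonMeasure (d := 4) (L := L) ρ β) =
      (∫ U, conj (X (gaugeTimeReflect (torusLift L U))) * X (configShift (-(Pi.single 0 s)) (torusLift L U))
          ∂(wilsonMeasure (d := 4) (L := L) ρ β)) +
        c * (∫ U, conj (X (gaugeTimeReflect (torusLift L U))) * Y (configShift (-(Pi.single 0 s)) (torusLift L U))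
          ∂(wilsonMeasure (d := 4) (L := L) ρ β)) +
        conj c * (∫ U, conj (Y (gaugeTimeReflect (torusLift L U))) * X (configShift (-(Pi.single 0 s)) (torusLift L U))
          ∂(wilsonMeasure (d := 4) (L := L) ρ β)) +
        conj c * c * (∫ U, conj (Y (gaugeTimeReflect (torusLift L U))) * Y (configShift (-(Pi.single 0 s)) (torusLift L U))
          ∂(wilsonMeasure (d := 4) (L := L) ρ β)) := by
  obtain ⟨CX, hCX⟩ := hXb
  obtain ⟨CY, hCY⟩ := hYb
  have hCX0 : 0 ≤ CX := (norm_nonneg _).trans (hCX (gaugeTimeReflect (torusLift L (Classical.arbitrary _))))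
  have hCY0 : 0 ≤ CY := (norm_nonneg _).trans (hCY (gaugeTimeReflect (torusLift L (Classical.arbitrary _))))
  -- the four integrable products
  have hI : ∀ (A B : LGConfig 4 G → ℂ), Measurable A → Measurable B → (∃ C : ℝ, ∀ U, ‖A U‖ ≤ C) →
      (∃ C : ℝ, ∀ U, ‖B U‖ ≤ C) →
      Integrable (fun U : GaugeConfig 4 L G => conj (A (gaugeTimeReflect (torusLift L U))) *
        B (configShift (-(Pi.single 0 s)) (torusLift L U))) (wilsonMeasure (d := 4) (L := L) ρ β) := by
    intro A B hA hB hAb hBb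
    obtain ⟨CA, hCA⟩ := hAb
    obtain ⟨CB, hCB⟩ := hBb
    refine cscl_integrable ρ hρ β ((Complex.continuous_conj.measurable.comp (cscl_measurable_comp hA L s).1).mul
      (cscl_measurable_comp hB L s).2) ⟨CA * CB, fun U => ?_⟩
    rw [norm_mul, Complex.norm_conj]
    have hCA0 : 0 ≤ CA := (norm_nonneg _).trans (hCA (gaugeTimeReflect (torusLift L U)))
    exact mul_le_mul (hCA _) (hCB _) (norm_nonneg _) hCA0
  have h1 := hI X X hXm hXm ⟨CX, hCX⟩ ⟨CX, hCX⟩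
  have h2 := hI X Y hXm hYm ⟨CX, hCX⟩ ⟨CY, hCY⟩
  have h3 := hI Y X hYm hXm ⟨CY, hCY⟩ ⟨CX, hCX⟩
  have h4 := hI Y Y hYm hYm ⟨CY, hCY⟩ ⟨CY, hCY⟩
  have hpt : ∀ U : GaugeConfig 4 L G,
      conj (X (gaugeTimeReflect (torusLift L U)) + c * Y (gaugeTimeReflect (torusLift L U))) *
        (X (configShift (-(Pi.single 0 s)) (torusLift L U)) + c * Y (configShift (-(Pi.single 0 s)) (torusLift L U))) =
      conj (X (gaugeTimeReflect (torusLift L U))) * X (configShift (-(Pi.single 0 s)) (torusLift L U)) +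
        c * (conj (X (gaugeTimeReflect (torusLift L U))) * Y (configShift (-(Pi.single 0 s)) (torusLift L U))) +
        conj c * (conj (Y (gaugeTimeReflect (torusLift L U))) * X (configShift (-(Pi.single 0 s)) (torusLift L U))) +
        conj c * c * (conj (Y (gaugeTimeReflect (torusLift L U))) * Y (configShift (-(Pi.single 0 s)) (torusLift L U))) := by
    intro U; simp only [map_add, map_mul]; ring
  simp_rw [hpt]
  rw [integral_add, integral_add, integral_add, integral_const_mul, integral_const_mul, integral_const_mul]
  · exact h1
  · exact h2.const_mul _
  · exact h1.add (h2.const_mul _)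
  · exact h3.const_mul _
  · exact (h1.add (h2.const_mul _)).add (h3.const_mul _)
  · exact h4.const_mul _


end Torus

/-- **Registered anchor of this file** (closed form of `cscl_cfgReflect_eq`, for the gate's `--supports` stub check):
the site reflection of `ℤ⁴` gauge fields is the bond reflection followed by the unit time translation. [folklore] -/
theorem cscl_anchor_forms :
    ∀ (G : Type) [Group G] [MeasurableSpace G] (U : LGConfig 4 G),
      cfgReflect U = configShift (Pi.single 0 1) (gaugeTimeReflect U) :=
  fun _ _ _ U => cscl_cfgReflect_eq U

end Summit.QuantumFields.YangMills.Theorems.ContinuumLegGivenGap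

end
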